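import Summits.CriticalPhenomena.PercolationContinuityZ3.Theorems.PercNearOneGluingNoHeavyLowerTailAntitheticCyclePlusRegroup
import HarnessLib

/-!
# `NoHeavyLowerTail` (stmt-CriticalPhenomena-4575) — antithetic cluster pairs: THEOREM C′, the BOUNDARY LAYER of the cycle, part 1 — classification
# of the non-bulk colourings and their clusters (prim-hp-2 gen 42; HOME/THEOREM-Cprime-delta2-cycle.md §2–§3, §12 (L4))

Support file (`--supports stmt-CriticalPhenomena-4575`, hull-port prover `prim-hp-2`, gen 42).  No definitions, no named facts, no sorries; standard
axioms.

A colouring `ω` of the cycle `v 0 = s, …, v (n−1)` is NON-BULK if `iLen ω + jLen ω + 2 > n` (…CyclePlusRegroup).  This file shows that the non-bulk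
colourings are exactly the BOUNDARY LAYER of THEOREM C′ and computes their clusters:
* `Cyc.Bulk.nonbulk_cases` — either the two `s`-pairs have the same colour and (`iLen + jLen = n − 1` — a near-full ARC — or `iLen = jLen = n` — all one
  colour), or they have different colours and `iLen + jLen = n` — a ONE-CHANGE colouring;
* `Cyc.Bulk.clusters_arc`, `clusters_full`, `clusters_oneChange` — the red/blue edge clusters in the three cases:
  `(runSet k (n−1−k), ∅)`, `(runSet n n, ∅)`, `(runSet i 0, runSet 0 (n−i))` (red versions; blue by complement);
* `Cyc.Bulk.mem_tset_oneChange_iff` — a one-change colouring at position `i` (`0 < i < n`) satisfies the avoidance constraints of `R ∌ s` iff `v i ∉ R`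
  (`Cyc.both_iff`); arcs and full colourings always do (`mem_tset_of_blue_empty`).
The counting of the boundary layer (BL′ of the theorem file, §6) is part 2.
[cite: VandenbergHaggstromKahn2005, §1 p. 3 (open cluster `C_s`)]
-/

noncomputable section

namespace Summit.CriticalPhenomena.PercolationContinuityZ3.Theorems

open Literature.Probability.Percolation
open scoped Classical symmDiff

namespace Antithetic

namespace Cyc

namespace Bulk

variable {V : Type*} {n : ℕ} {v : ℕ → V}

section Classification

variable (hn : 3 ≤ n) (hinj : ∀ i j, i < n → j < n → v i = v j → i = j) (hper : v n = v 0)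
include hn hinj hper

omit hinj hper in
/-- **Classification of the non-bulk colourings.**  If `iLen ω + jLen ω + 2 > n` then either the two `s`-pairs have the same colour and the colouring is a
near-full arc (`iLen + jLen = n − 1`) or monochromatic on the cycle (`iLen = jLen = n`), or they have different colours and the colouring is one-change
(`iLen + jLen = n`). [this work] -/
theorem nonbulk_cases (ω : Set (Sym2 V)) (hnb : n < iLen n v ω + jLen n v ω + 2) :
    ((edge v 0 ∈ ω ↔ edge v (n - 1) ∈ ω) ∧ (iLen n v ω + jLen n v ω = n - 1 ∨ (iLen n v ω = n ∧ jLen n v ω = n))) ∨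
      (¬ (edge v 0 ∈ ω ↔ edge v (n - 1) ∈ ω) ∧ iLen n v ω + jLen n v ω = n) := by
  have hcw := cwRun_iLen (n := n) (v := v) ω
  have hccw := ccwRun_jLen (n := n) (v := v) ω
  have hi := iLen_le (n := n) (v := v) ω
  have hj := jLen_le (n := n) (v := v) ω
  set i := iLen n v ω with hi_def
  set j := jLen n v ω with hj_def
  by_cases hsame : (edge v 0 ∈ ω ↔ edge v (n - 1) ∈ ω)
  · left
    refine ⟨hsame, ?_⟩
    by_cases hin : i < n
    · -- the cw stopper `edge i` has the other colour; it cannot lie inside the ccw run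
      left
      have hstop := hcw.2 hin
      by_contra hne
      have hge : n ≤ i + j := by omega
      -- edge i = edge (n-1-(n-1-i)) with n-1-i < j
      have hrun := hccw.1 (n - 1 - i) (by omega)
      rw [show n - 1 - (n - 1 - i) = i by omega] at hrun
      exact hstop (hrun.trans hsame.symm)
    · right
      have hin' : i = n := le_antisymm hi (not_lt.1 hin)
      refine ⟨hin', ?_⟩
      -- all pairs have the colour of edge 0, so the ccw run is full
      by_contra hjn
      have hjlt : j < n := lt_of_le_of_ne hj hjn
      have hstop := hccw.2 hjlt
      have hrun := hcw.1 (n - 1 - j) (by omega)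
      exact hstop (hrun.trans hsame)
  · right
    refine ⟨hsame, ?_⟩
    -- different colours: the runs are disjoint, so i + j ≤ n; i + j = n - 1 would put both stoppers on the same pair
    have hin : i < n := by
      by_contra h
      have : i = n := le_antisymm hi (not_lt.1 h)
      have hrun := hcw.1 (n - 1) (by omega)
      exact hsame hrun.symm
    have hjn : j < n := by
      by_contra h
      have : j = n := le_antisymm hj (not_lt.1 h)
      have hrun := hccw.1 (n - 1) (by omega)
      rw [show n - 1 - (n - 1) = 0 by omega] at hrun
      exact hsame hrun
    rcases Nat.lt_trichotomy (i + j) n with hlt | heq | hgt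
    · -- i + j ≤ n - 1; bulk excluded so i + j = n - 1: the cw stopper edge i is the ccw stopper edge (n-1-j)
      exfalso
      have hij : i + j = n - 1 := by omega
      have h1 := hcw.2 hin
      have h2 := hccw.2 hjn
      rw [show n - 1 - j = i by omega] at h2
      -- edge i ∈ ω ↔ ¬(edge 0 colour) and edge i ∈ ω ↔ ¬(edge (n-1) colour) contradict the colours being different
      tauto
    · exact heq
    · -- i + j > n: the runs overlap at the pair `edge (n - j)`, impossible with different colours
      exfalso
      have hj1 : 1 ≤ j := one_le_jLen (n := n) (v := v) ω (by omega)
      have hrun1 := hcw.1 (n - j) (by omega)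
      have hrun2 := hccw.1 (j - 1) (by omega)
      rw [show n - 1 - (j - 1) = n - j by omega] at hrun2
      exact hsame (hrun1.symm.trans hrun2)

end Classification

section Clusters

variable (hn : 3 ≤ n) (hinj : ∀ i j, i < n → j < n → v i = v j → i = j) (hper : v n = v 0)
include hn hinj hper

/-- **Clusters of a near-full red arc**: both `s`-pairs red, runs `k` and `n−1−k`: red cluster `runSet k (n−1−k)` (all pairs but `edge k`), blue `∅`. [this work] -/
theorem clusters_arc {ω : Set (Sym2 V)} {k : ℕ} (hcw : ω ∈ cwRun n v True k) (hccw : ω ∈ ccwRun n v True (n - 1 - k)) (hk1 : 1 ≤ k)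
    (hk2 : k + 2 ≤ n) :
    openEdgeCluster (ω ∩ edgeSet n v) (v 0) = runSet n v k (n - 1 - k) ∧ openEdgeCluster (ωᶜ ∩ edgeSet n v) (v 0) = ∅ := by
  have h1 : pre n v ω = k := cwRun_pre ω hcw trivial (by omega)
  have h2 : suf n v ω = n - 1 - k := ccwRun_suf ω hccw trivial (by omega)
  have h3 : pre n v ωᶜ = 0 := (cwRun_pre_other ω hcw (by omega)).1 trivial
  have h4 : suf n v ωᶜ = 0 := (ccwRun_suf_other ω hccw (by omega)).1 trivial
  exact ⟨by rw [cluster_eq_runSet hn hinj hper, h1, h2], by rw [cluster_eq_runSet hn hinj hper, h3, h4, runSet_zero]⟩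

/-- **Clusters of the all-red colouring**: red cluster `runSet n n` (every pair of the cycle), blue `∅`. [this work] -/
theorem clusters_full {ω : Set (Sym2 V)} (hcw : ω ∈ cwRun n v True n) (hccw : ω ∈ ccwRun n v True n) :
    openEdgeCluster (ω ∩ edgeSet n v) (v 0) = runSet n v n n ∧ openEdgeCluster (ωᶜ ∩ edgeSet n v) (v 0) = ∅ := by
  have h1 : pre n v ω = n := cwRun_pre ω hcw trivial le_rfl
  have h2 : suf n v ω = n := ccwRun_suf ω hccw trivial le_rfl
  have h3 : pre n v ωᶜ = 0 := (cwRun_pre_other ω hcw (by omega)).1 trivial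
  have h4 : suf n v ωᶜ = 0 := (ccwRun_suf_other ω hccw (by omega)).1 trivial
  exact ⟨by rw [cluster_eq_runSet hn hinj hper, h1, h2], by rw [cluster_eq_runSet hn hinj hper, h3, h4, runSet_zero]⟩

omit hn hinj hper in
/-- `runSet n n` is the whole edge set of the cycle. [this work] -/
theorem runSet_full : runSet n v n n = edgeSet n v := by
  ext e
  simp only [runSet, edgeSet, Set.mem_setOf_eq]
  constructor
  · rintro ⟨k, hk, rfl, -⟩; exact ⟨k, hk, rfl⟩
  · rintro ⟨k, hk, rfl⟩; exact ⟨k, hk, rfl, Or.inl hk⟩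

/-- **Clusters of a one-change colouring** (red clockwise run `i`, blue counter-clockwise run `n − i`): red `runSet i 0`, blue `runSet 0 (n−i)`. [this work] -/
theorem clusters_oneChange {ω : Set (Sym2 V)} {i : ℕ} (hcw : ω ∈ cwRun n v True i) (hccw : ω ∈ ccwRun n v False (n - i)) (hi1 : 1 ≤ i)
    (hin : i + 1 ≤ n) :
    openEdgeCluster (ω ∩ edgeSet n v) (v 0) = runSet n v i 0 ∧ openEdgeCluster (ωᶜ ∩ edgeSet n v) (v 0) = runSet n v 0 (n - i) := by
  have h1 : pre n v ω = i := cwRun_pre ω hcw trivial (by omega)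
  have h2 : suf n v ω = 0 := (ccwRun_suf_other ω hccw (by omega)).2 id
  have h3 : pre n v ωᶜ = 0 := (cwRun_pre_other ω hcw (by omega)).1 trivial
  have h4 : suf n v ωᶜ = n - i := ccwRun_suf_compl ω hccw id (Nat.sub_le _ _)
  exact ⟨by rw [cluster_eq_runSet hn hinj hper, h1, h2], by rw [cluster_eq_runSet hn hinj hper, h3, h4]⟩

omit hn hinj hper in
/-- A colouring whose blue cluster is empty satisfies every avoidance constraint of `R ∌ s` (no vertex is blue-reached except `s`). [this work] -/
theorem mem_tset_of_blue_empty [Fintype V] (R : Set V) (hRs : v 0 ∉ R) {ω : Set (Sym2 V)}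
    (hblue : openEdgeCluster (ωᶜ ∩ edgeSet n v) (v 0) = ∅) : ω ∈ Peel.tset (edgeSet n v) (v 0) R ∅ := by
  rw [Peel.mem_tset]
  refine ⟨fun r hr hboth => ?_, fun x hx => absurd hx (Set.notMem_empty _)⟩
  have h2 := hboth.2
  rw [reach_iff_seen, hblue] at h2
  rcases h2 with h | ⟨g, hg, -⟩
  · exact hRs (h ▸ hr)
  · exact hg

omit hn hinj hper in
/-- A colouring whose red cluster is empty satisfies every avoidance constraint of `R ∌ s`. [this work] -/
theorem mem_tset_of_red_empty [Fintype V] (R : Set V) (hRs : v 0 ∉ R) {ω : Set (Sym2 V)}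
    (hred : openEdgeCluster (ω ∩ edgeSet n v) (v 0) = ∅) : ω ∈ Peel.tset (edgeSet n v) (v 0) R ∅ := by
  rw [Peel.mem_tset]
  refine ⟨fun r hr hboth => ?_, fun x hx => absurd hx (Set.notMem_empty _)⟩
  have h1 := hboth.1
  rw [reach_iff_seen, hred] at h1
  rcases h1 with h | ⟨g, hg, -⟩
  · exact hRs (h ▸ hr)
  · exact hg

/-- **Constraints of a one-change colouring.**  With red run `i` and blue run `n − i` (`0 < i < n`), the doubly reached vertices other than `s` are exactly
`v i`; so the colouring satisfies the constraints of `R ∌ s` iff `v i ∉ R`. [this work] -/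
theorem mem_tset_oneChange_iff [Fintype V] (R : Set V) (hRs : v 0 ∉ R) {ω : Set (Sym2 V)} {i : ℕ} (hcw : ω ∈ cwRun n v True i)
    (hccw : ω ∈ ccwRun n v False (n - i)) (hi1 : 1 ≤ i) (hin : i + 1 ≤ n) :
    ω ∈ Peel.tset (edgeSet n v) (v 0) R ∅ ↔ v i ∉ R := by
  obtain ⟨hC, hC'⟩ := clusters_oneChange hn hinj hper hcw hccw hi1 hin
  have reach_iff_idx : ∀ a, 0 < a → a < n →
      (((openGraph (ω ∩ edgeSet n v)).Reachable (v 0) (v a) ∧ (openGraph (ωᶜ ∩ edgeSet n v)).Reachable (v 0) (v a)) ↔ a = i) := by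
    intro a ha0 han
    rw [reach_iff_seen, reach_iff_seen, hC, hC', seen_iff hn hinj hper ha0 han, seen_iff hn hinj hper ha0 han]
    omega
  rw [Peel.mem_tset]
  constructor
  · rintro ⟨hR, -⟩ hiR
    exact hR (v i) hiR ((reach_iff_idx i (by omega) (by omega)).2 rfl)
  · intro hiR
    refine ⟨fun r hr hboth => ?_, fun x hx => absurd hx (Set.notMem_empty _)⟩
    obtain ⟨j, ⟨hj, rfl⟩ | ⟨hj, rfl⟩⟩ := (reach_iff ω hn hinj hper r).1 hboth.1
    · have hjn : j ≤ n := hj.trans (pre_le ω)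
      rcases Nat.eq_zero_or_pos j with rfl | hj0
      · exact hRs hr
      rcases Nat.lt_or_ge j n with hjlt | hjge
      · have := (reach_iff_idx j hj0 hjlt).1 hboth
        subst this
        exact hiR hr
      · have : j = n := le_antisymm hjn hjge
        subst this; rw [hper] at hr; exact hRs hr
    · by_cases hj0 : n - j = 0
      · rw [hj0] at hr; exact hRs hr
      by_cases hjz : j = 0
      · subst hjz; rw [Nat.sub_zero, hper] at hr; exact hRs hr
      have := (reach_iff_idx (n - j) (by omega) (by omega)).1 hboth
      rw [this] at hr
      exact hiR hr

end Clusters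

end Bulk

end Cyc

end Antithetic

end Summit.CriticalPhenomena.PercolationContinuityZ3.Theorems
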